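import Summits.BirchSwinnertonDyer.BirchSwinnertonDyer.Theorems.PrintX11aMultWinding
import Summits.BirchSwinnertonDyer.BirchSwinnertonDyer.Theorems.PrintX11aUpperNonSurjFiveMuAnOfOrbitUnit
import Summits.BirchSwinnertonDyer.BirchSwinnertonDyer.Theorems.PrintX11aUpperNonSurjFiveOrbitUnitOfMultTeichSpan
import Summits.BirchSwinnertonDyer.Rank1Residual.X11a.Cells
import Summits.BirchSwinnertonDyer.Rank1Residual.X11a.MuLambdaSplit
import Literature.NumberTheory.EllipticCurves.PAdicLFunctionMuInvariantCertificateProofs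
import HarnessLib

/-!
# Crux `X11aLowerHalf` (item stmt-BirchSwinnertonDyer-19064), registered stub `stub_muAnDeepFive` — what the tree now PROVES
# class-wide at `p ≥ 5` (the «some even branch» half) and the ONE open input it shares with crux U5 (item 20614)

Cell `bsd-print-x11a`, width seat bsd-line-x11a-p1-w2 g3 (`--supports stmt-BirchSwinnertonDyer-19064`). Theorems only (no
definition, no named fact minted, no `sorry`); BSD is not proved by any of this; the registered stub
`stub_muAnDeepFive : ∀ W p, ClassX11a W p → 5 ≤ p → ¬ X11a.ShaAnUnit W p → X11a.MuAnZeroAt W p` (Greenberg's analytic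
`μ(L_p(E, ω⁰)) = 0` on the deep X11a pairs at `p ≥ 5`) stays OPEN class-wide.

* §1 `ClassX11a.exists_one_le_norm_ratPlusSymbol_div_prime_pow` — **PROVED, fact-free, every X11a pair (any odd `p`, unit or
  deep, either image)**: for every newform `f` of `E` some plus symbol `[u/pᵏ]⁺_f` (`k ≥ 1`, `p ∤ u`) is a `p`-adic unit — the even
  Mazur–Tate–Teitelbaum measure of `E` on `ℤ_pˣ` is not divisible by `p`, i.e. SOME even tame branch `L_p(E, ω^{2i})` has `μ = 0`
  (`MultWinding.exists_one_le_norm_ratPlusSymbol_div_prime_pow`, the p-generic Atkin–Lehner orbit trick in `GL₂(ℤ[1/p])`).  At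
  `p = 3` the only even branch is `ω⁰` (x11a-p2 g2's theorem); at `p ≥ 5` the `ω⁰` branch is the push-forward of the measure to
  `1 + pℤ_p` (Teichmüller ORBIT SUMS), which a single unit symbol does not control — this is exactly the residual.
* §1b `exists_one_le_norm_ratPlusSymbol_div_prime_pow_ge` — units at EVERY large level `k ≥ K` (the `U_p`-relation climbs:
  a unit `[u/pᵏ]⁺` forces a unit `[(u + jpᵏ)/p^{k+1}]⁺`), i.e. `μ_E⁺ ≢ 0 (mod p)` on balls of every small radius.
* §2 `muAnZeroAt_of_multMuAnAt` — dictionary: U5's per-pair μ-claim `MultTeich.MultMuAnAt W p` IS `X11a.MuAnZeroAt W p`.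
* §3 `muAnDeepFive_of_multTeichOrbitUnitAt` — **19064's `p ≥ 5` μ-stub ⟸ unit Teichmüller orbit sums on the deep X11a pairs**
  (`MultTeich.MultTeichOrbitUnitAt`, U5's S3 currency) + Mazur 1978 Cor. 4.1 (+ Wuthrich Cor. 18, carried unused by S3's signature);
  §4 `muAnDeepFive_of_multTeichSpanGen` — **⟸ B⁰ at the multiplicative levels `pM` for every prime `p ≥ 5`**
  (`MultTeich.MultTeichSpanGen M p`, U5's registered stub S1, census-true, OPEN) + the same two facts.  So, IN THE KERNEL: crux L
  (19064) at `p ≥ 5`, crux U5 (20614) and K2's corner twin (19948) have ONE shared open input beyond named facts — S1 / unit orbit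
  sums = Greenberg Conj. 1.11 (analytic, branch `ω⁰`) at a multiplicative prime; and its «some even branch» shadow is a THEOREM (§1).
* §5 `teichOrbitSum_unit_or_orbit_nonconstant` / `multTeichOrbitUnitAt_or_exists_orbit_nonconstant` — the per-pair ORBIT DICHOTOMY the unit
  symbol yields toward `ω⁰`: a unit Teichmüller ORBIT SUM (the `ω⁰`-certificate) OR an orbit with two incongruent plus symbols.
beyond-print theorem: §1 yes (see `…MultWinding`); §2–§5 no (bookkeeping / one-line consequences).  PARTITION 0.
References: [MazurTateTeitelbaum1986Invent] §I.10 (10.1), §I.12–I.13; [GreenbergLNM1716] Conj. 1.11; [Mazur1978] Cor. 4.1;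
[Manin1972] Prop. 1.4; [Vaserstein1972SL2] Theorem.
-/

set_option linter.dupNamespace false
set_option autoImplicit false

noncomputable section

open scoped MatrixGroups ModularForm

open CongruenceSubgroup WeierstrassCurve
  Literature.NumberTheory.EllipticCurves Literature.NumberTheory.EllipticCurves.ModularForms
  Literature.NumberTheory.EllipticCurves.Rank1Residual
  Summit.BirchSwinnertonDyer.Rank1Residual
  Summit.BirchSwinnertonDyer.BirchSwinnertonDyer.Cruxes.UpperNonSurjFive.MultTeich

namespace Summit.BirchSwinnertonDyer.BirchSwinnertonDyer.Theorems.X11aLowerHalfEvenBranch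

/-! ### §1 The winding theorem on class X11a (fact-free) -/

/-- **Some even branch has `μ^an = 0` at EVERY X11a pair** (any odd multiplicative `p`, unit or deep, surjective or not): for
every newform `f` of `E = W`, some plus symbol `[u/pᵏ]⁺_f` with `k ≥ 1`, `p ∤ u` — a value (up to the sign `a_pᵏ`) of the
Mazur–Tate–Teitelbaum measure `μ_E` on `ℤ_pˣ` — has `p`-adic norm `≥ 1`.  Fact-free: `ClassX11a` supplies `p ≠ 2`,
multiplicative reduction and irreducibility; the rank and (ram) clauses are not used.
[cite: MazurTateTeitelbaum1986Invent, §I.10 (10.1)] [cite: GreenbergLNM1716, Conj. 1.11 (p. 61)] [cite: Manin1972, Prop. 1.4] -/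
theorem _root_.Summit.BirchSwinnertonDyer.Rank1Residual.ClassX11a.exists_one_le_norm_ratPlusSymbol_div_prime_pow
    {W : WeierstrassCurve ℚ} [W.IsElliptic] [W.IsGloballyMinimal] {p : ℕ} [Fact p.Prime] (hX : ClassX11a W p)
    {N : ℕ} [NeZero N] {f : CuspForm (Gamma0 N) 2} (hf : IsNewformOf W f) :
    ∃ (k : ℕ) (u : ℤ), 1 ≤ k ∧ ¬ (p : ℤ) ∣ u ∧
      1 ≤ ‖((ratPlusSymbol f ((u : ℚ) / (p : ℚ) ^ k) : ℚ) : ℚ_[p])‖ :=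
  MultWinding.exists_one_le_norm_ratPlusSymbol_div_prime_pow W p hX.2.1 hX.2.2.1 hX.2.2.2.1 hf

/-- The `∀`-form over the whole class, in the shape of the registered stub's binder block (no `5 ≤ p`, no `¬ ShaAnUnit` needed):
the «some even branch» shadow of `stub_muAnDeepFive` is a theorem of the tree. [cite: GreenbergLNM1716, Conj. 1.11 (p. 61)]
[cite: MazurTateTeitelbaum1986Invent, §I.10 (10.1)] -/
theorem forall_classX11a_exists_unit_plusSymbol :
    ∀ (W : WeierstrassCurve ℚ) [W.IsElliptic] [W.IsGloballyMinimal] (p : ℕ) [Fact p.Prime],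
      ClassX11a W p → ∀ {N : ℕ} [NeZero N] (f : CuspForm (Gamma0 N) 2), IsNewformOf W f →
        ∃ (k : ℕ) (u : ℤ), 1 ≤ k ∧ ¬ (p : ℤ) ∣ u ∧
          1 ≤ ‖((ratPlusSymbol f ((u : ℚ) / (p : ℚ) ^ k) : ℚ) : ℚ_[p])‖ :=
  fun _ _ _ _ _ hX _ _ _ hf ↦ hX.exists_one_le_norm_ratPlusSymbol_div_prime_pow hf

/-! ### §1b Units at EVERY large level (the `U_p`-relation climbs) -/

/-- **Climbing one level**: at a multiplicative prime `p` (`a_p = ±1`), a unit plus symbol `[u/pᵏ]⁺_f` with `k ≥ 1`, `p ∤ u`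
forces a unit plus symbol `[u'/p^{k+1}]⁺_f` with `p ∤ u'` (indeed `u' = u + j pᵏ`): the `U_p`-relation
`a_p [u/pᵏ]⁺ = Σ_{j mod p} [(u + j pᵏ)/p^{k+1}]⁺` (MTT §I.4 (4.2) at `p ∣ N`) and the ultrametric inequality.
[cite: MazurTateTeitelbaum1986Invent, §I.4 (4.2), §I.10] -/
theorem exists_one_le_norm_ratPlusSymbol_succ
    {W : WeierstrassCurve ℚ} [W.IsElliptic] [W.IsGloballyMinimal] {p : ℕ} [Fact p.Prime]
    (hmult : W.HasMultiplicativeReductionAtPrime p)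
    {N : ℕ} [NeZero N] {f : CuspForm (Gamma0 N) 2} (hf : IsNewformOf W f) {k : ℕ} (hk : 1 ≤ k) {u : ℤ}
    (hu : ¬ (p : ℤ) ∣ u) (hunit : 1 ≤ ‖((ratPlusSymbol f ((u : ℚ) / (p : ℚ) ^ k) : ℚ) : ℚ_[p])‖) :
    ∃ u' : ℤ, ¬ (p : ℤ) ∣ u' ∧ 1 ≤ ‖((ratPlusSymbol f ((u' : ℚ) / (p : ℚ) ^ (k + 1)) : ℚ) : ℚ_[p])‖ := by
  have hp : p.Prime := Fact.out
  have hQ : coeffField f = ⊥ := hf.coeffField_eq_bot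
  have hrat : ∀ r : ℚ, (ratPlusSymbol f r : ℝ) = normalizedPlusSymbol f r :=
    fun r ↦ ratCast_ratPlusSymbol_holds hf.1 hQ r
  obtain ⟨hpN, -, ap, hap, hap'⟩ := hf.dvd_level_and_not_sq_dvd_of_multiplicative hmult
  have hU := intCast_mul_ratPlusSymbol_of_dvd p hf.1 hp hpN hap hrat ((u : ℚ) / (p : ℚ) ^ k)
  -- the `j`-th term is `[(u + j pᵏ)/p^{k+1}]⁺`
  have hterm : ∀ j : Fin p, ((u : ℚ) / (p : ℚ) ^ k + ((j : ℕ) : ℚ)) / p =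
      ((u + ((j : ℕ) : ℤ) * (p : ℤ) ^ k : ℤ) : ℚ) / (p : ℚ) ^ (k + 1) := by
    intro j
    have hp0 : (p : ℚ) ≠ 0 := by exact_mod_cast hp.ne_zero
    push_cast
    field_simp
    ring
  by_contra H
  push Not at H
  have hsmall : ∀ j : Fin p,
      ‖((ratPlusSymbol f (((u : ℚ) / (p : ℚ) ^ k + ((j : ℕ) : ℚ)) / p) : ℚ) : ℚ_[p])‖ < 1 := by
    intro j
    rw [hterm j]
    refine H _ fun hdvd ↦ hu ?_
    have : (p : ℤ) ∣ ((j : ℕ) : ℤ) * (p : ℤ) ^ k :=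
      dvd_mul_of_dvd_right (dvd_pow_self (p : ℤ) (by omega)) _
    simpa using (Int.dvd_iff_dvd_of_dvd_add hdvd).mpr this
  have hsum : ‖((∑ j : Fin p, ratPlusSymbol f (((u : ℚ) / (p : ℚ) ^ k + ((j : ℕ) : ℚ)) / p) : ℚ) : ℚ_[p])‖ < 1 := by
    push_cast
    exact Finset.sum_induction _ (fun x => ‖x‖ < 1)
      (fun a b ha hb => lt_of_le_of_lt (Padic.nonarchimedean a b) (max_lt ha hb)) (by simp)
      (fun j _ ↦ hsmall j)
  have hap1 : ‖((ap : ℚ) : ℚ_[p])‖ = 1 := by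
    rcases hap' with h | h <;> simp [h]
  have hlhs : 1 ≤ ‖(((ap : ℚ) * ratPlusSymbol f ((u : ℚ) / (p : ℚ) ^ k) : ℚ) : ℚ_[p])‖ := by
    push_cast; rw [norm_mul]; push_cast at hap1; rw [hap1, one_mul]; exact hunit
  rw [hU] at hlhs
  exact absurd hsum (not_lt.mpr hlhs)

/-- **Units at every large level**: at a multiplicative ODD prime `p` with `E[p]` irreducible, for every bound `K` some plus symbol
`[u/pᵏ]⁺_f` with `k ≥ K`, `k ≥ 1`, `p ∤ u` is a `p`-adic unit (the winding theorem + climbing).  In measure terms: `μ_E⁺` is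
non-zero modulo `p` on balls of every small radius. [cite: MazurTateTeitelbaum1986Invent, §I.4 (4.2), §I.10]
[cite: GreenbergLNM1716, Conj. 1.11 (p. 61)] -/
theorem exists_one_le_norm_ratPlusSymbol_div_prime_pow_ge
    (W : WeierstrassCurve ℚ) [W.IsElliptic] [W.IsGloballyMinimal] (p : ℕ) [Fact p.Prime] (hp2 : p ≠ 2)
    (hmult : W.HasMultiplicativeReductionAtPrime p) (hirr : W.HasIrreducibleModPGaloisRep p)
    {N : ℕ} [NeZero N] {f : CuspForm (Gamma0 N) 2} (hf : IsNewformOf W f) (K : ℕ) :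
    ∃ (k : ℕ) (u : ℤ), K ≤ k ∧ 1 ≤ k ∧ ¬ (p : ℤ) ∣ u ∧
      1 ≤ ‖((ratPlusSymbol f ((u : ℚ) / (p : ℚ) ^ k) : ℚ) : ℚ_[p])‖ := by
  obtain ⟨k, u, hk, hu, hunit⟩ :=
    MultWinding.exists_one_le_norm_ratPlusSymbol_div_prime_pow W p hp2 hmult hirr hf
  -- climb from level `k` to level `k + n` for every `n`
  have climb : ∀ n : ℕ, ∃ u' : ℤ, ¬ (p : ℤ) ∣ u' ∧
      1 ≤ ‖((ratPlusSymbol f ((u' : ℚ) / (p : ℚ) ^ (k + n)) : ℚ) : ℚ_[p])‖ := by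
    intro n
    induction n with
    | zero => exact ⟨u, hu, by simpa using hunit⟩
    | succ n ih =>
      obtain ⟨u', hu', h'⟩ := ih
      obtain ⟨u'', hu'', h''⟩ := exists_one_le_norm_ratPlusSymbol_succ hmult hf (k := k + n) (by omega) hu' h'
      exact ⟨u'', hu'', by simpa [Nat.add_assoc] using h''⟩
  obtain ⟨u', hu', h'⟩ := climb K
  exact ⟨k + K, u', by omega, by omega, hu', h'⟩

/-! ### §2 Dictionary: U5's `MultMuAnAt` is `X11a.MuAnZeroAt` -/

/-- **`MultTeich.MultMuAnAt W p → X11a.MuAnZeroAt W p`** (pure logic: the split clause reads THE split function through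
`isMultPAdicLFunctionOf_one_iff`, the non-split clause THE `a = −1` function). [folklore] -/
theorem muAnZeroAt_of_multMuAnAt {W : WeierstrassCurve ℚ} [W.IsElliptic] [W.IsGloballyMinimal] {p : ℕ} [Fact p.Prime]
    (h : MultMuAnAt W p) : X11a.MuAnZeroAt W p := by
  intro N _ f hf ϖ hϖ
  refine ⟨fun hns L hL ↦ h f hf ϖ hϖ (-1) L (fun hs ↦ absurd hs hns) (fun _ ↦ rfl) hL,
    fun hs L hL ↦ h f hf ϖ hϖ 1 L (fun _ ↦ rfl) (fun hns ↦ absurd hs hns)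
      ((isMultPAdicLFunctionOf_one_iff L).mpr hL)⟩

/-- **`X11a.MuAnZeroAt W p → MultTeich.MultMuAnAt W p`** (the converse reading; pure logic). [folklore] -/
theorem multMuAnAt_of_muAnZeroAt {W : WeierstrassCurve ℚ} [W.IsElliptic] [W.IsGloballyMinimal] {p : ℕ} [Fact p.Prime]
    (h : X11a.MuAnZeroAt W p) : MultMuAnAt W p := by
  intro N _ f hf ϖ hϖ a L hsa hna hL
  by_cases hs : W.HasSplitMultiplicativeReductionAtPrime p
  · have ha : a = 1 := hsa hs
    subst ha
    exact (h f hf ϖ hϖ).2 hs L ((isMultPAdicLFunctionOf_one_iff L).mp hL)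
  · have ha : a = -1 := hna hs
    subst ha
    exact (h f hf ϖ hϖ).1 hs L hL

/-! ### §3 The registered `p ≥ 5` μ-stub of 19064 from unit Teichmüller orbit sums (U5's S3 currency) -/

/-- **`stub_muAnDeepFive` ⟸ unit Teichmüller orbit sums on the deep X11a pairs at `p ≥ 5`** (+ Mazur 1978 Cor. 4.1 for
`‖ϖ‖_p = 1`; Wuthrich Cor. 18 is carried by S3's registered signature and not used): U5's landed S3
`MultTeich.multMuAnAt_of_orbitUnitAt` read through §2.  CONDITIONAL (named facts as hypotheses); closes nothing.
[cite: MazurTateTeitelbaum1986Invent, §I.10 (10.1), §I.12–I.13] [cite: Mazur1978, Cor. 4.1] -/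
theorem muAnDeepFive_of_multTeichOrbitUnitAt (hMz : mazur_not_dvd_maninConstant_of_odd)
    (h18 : Wuthrich2014.corollary18_padicLFunction_mem_iwasawaAlgebra_multiplicative)
    (horb : ∀ (W : WeierstrassCurve ℚ) [W.IsElliptic] [W.IsGloballyMinimal] (p : ℕ) [Fact p.Prime],
      ClassX11a W p → 5 ≤ p → ¬ X11a.ShaAnUnit W p → MultTeichOrbitUnitAt W p) :
    ∀ (W : WeierstrassCurve ℚ) [W.IsElliptic] [W.IsGloballyMinimal] (p : ℕ) [Fact p.Prime],
      ClassX11a W p → 5 ≤ p → ¬ X11a.ShaAnUnit W p → X11a.MuAnZeroAt W p := by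
  intro W _ _ p _ hX hp5 hdeep
  exact muAnZeroAt_of_multMuAnAt
    (multMuAnAt_of_orbitUnitAt hMz h18 W p hX.2.1 hX.2.2.1 hX.2.2.2.1 (horb W p hX hp5 hdeep))

/-! ### §4 … and from B⁰ at the multiplicative levels `pM`, all primes `p ≥ 5` (U5's registered stub S1, OPEN) -/

/-- **`stub_muAnDeepFive` ⟸ `MultTeichSpanGen M p` for every prime `p ≥ 5` and every `M` prime to `p`** (+ Mazur Cor. 4.1,
Wuthrich Cor. 18 carried): U5's landed S2 (`MultTeich.orbitUnitAt_of_multTeichSpanGen`, pointwise odd-`p` form) and §3.  The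
deep/unit and rank clauses are not used: S1 gives the μ-claim at EVERY multiplicative irreducible pair.  CONDITIONAL; closes
nothing (S1 is OPEN; census-true at every level tested by the cell's three engines). [cite: Manin1972, Prop. 1.4 and Thm. 1.9]
[cite: MazurTateTeitelbaum1986Invent, §I.10 (10.1)] [cite: Mazur1978, Cor. 4.1] -/
theorem muAnDeepFive_of_multTeichSpanGen
    (hS1 : ∀ p : ℕ, p.Prime → 5 ≤ p → ∀ M : ℕ, ¬ p ∣ M → MultTeichSpanGen M p)
    (hMz : mazur_not_dvd_maninConstant_of_odd)
    (h18 : Wuthrich2014.corollary18_padicLFunction_mem_iwasawaAlgebra_multiplicative) :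
    ∀ (W : WeierstrassCurve ℚ) [W.IsElliptic] [W.IsGloballyMinimal] (p : ℕ) [Fact p.Prime],
      ClassX11a W p → 5 ≤ p → ¬ X11a.ShaAnUnit W p → X11a.MuAnZeroAt W p :=
  muAnDeepFive_of_multTeichOrbitUnitAt hMz h18 fun W _ _ p _ hX hp5 _ ↦
    orbitUnitAt_of_multTeichSpanGen W p hX.2.1 (hS1 p Fact.out hp5) hX.2.2.1 hX.2.2.2.1

/-- **The whole-class form** (no `5 ≤ p`, no deep clause): S1 at every odd prime ⟹ `X11a.MuAnZeroAt` at EVERY X11a pair — at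
`p = 3` this is already a THEOREM without S1 (x11a-p2 g2 `MultThreeMuAn.muAnZeroAt_three_of_mult_of_irr`, mod Mazur), so only
`p ≥ 5` carries content. CONDITIONAL; closes nothing. [cite: Manin1972, Prop. 1.4 and Thm. 1.9] [cite: Mazur1978, Cor. 4.1] -/
theorem muAnZeroAt_of_classX11a_of_multTeichSpanGen
    (hS1 : ∀ p : ℕ, p.Prime → p ≠ 2 → ∀ M : ℕ, ¬ p ∣ M → MultTeichSpanGen M p)
    (hMz : mazur_not_dvd_maninConstant_of_odd)
    (h18 : Wuthrich2014.corollary18_padicLFunction_mem_iwasawaAlgebra_multiplicative)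
    {W : WeierstrassCurve ℚ} [W.IsElliptic] [W.IsGloballyMinimal] {p : ℕ} [Fact p.Prime] (hX : ClassX11a W p) :
    X11a.MuAnZeroAt W p :=
  muAnZeroAt_of_multMuAnAt
    (multMuAnAt_of_orbitUnitAt hMz h18 W p hX.2.1 hX.2.2.1 hX.2.2.2.1
      (orbitUnitAt_of_multTeichSpanGen W p hX.2.1 (hS1 p Fact.out hX.2.1) hX.2.2.1 hX.2.2.2.1))

/-! ### §5 The per-newform ORBIT DICHOTOMY at a multiplicative odd prime (what the unit symbol does give toward `ω⁰`) -/

/-- **Orbit dichotomy.** For `E = W/ℚ` with multiplicative reduction at an odd prime `p`, `E[p]` irreducible, and a newform `f` of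
`E`: at some level `n ≥ 1` and some unit `a mod pⁿ`, EITHER the Teichmüller orbit sum `Σ_{t^{p−1}=1} [t a/pⁿ]⁺_f` is a `p`-adic unit
(the `ω⁰`-certificate at this `f`: a unit value of the push-forward of `μ_E` to `1 + pℤ_p`; via U5's S3 `MultTeich.multMuAnAt_of_orbitUnitAt`
and §2 this is `X11a.MuAnZeroAt` when it holds for every newform of `W`), OR the orbit of `a` carries two plus symbols NOT congruent
modulo `p` (`‖[t a/pⁿ]⁺ − [a/pⁿ]⁺‖_p ≥ 1` for some `t^{p−1} = 1`: the mod-`p` measure is not `μ_{p−1}`-invariant on that orbit, i.e. it has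
a non-trivial even tame component there).  Proof: the unit symbol `[u/pᵏ]⁺` of §1; if every symbol on the orbit of `a = u mod pᵏ` were
congruent to it, the orbit sum would be `(p−1)[u/pᵏ]⁺ +` (small), a unit.  Uses `image_toZModPow_rootsOfUnity_eq_filter` (the orbit has
exactly `p − 1` points). [cite: MazurTateTeitelbaum1986Invent, §I.10 (10.1)] [cite: Washington1997, §5.1] [cite: GreenbergLNM1716, Conj. 1.11] -/
theorem teichOrbitSum_unit_or_orbit_nonconstant
    (W : WeierstrassCurve ℚ) [W.IsElliptic] [W.IsGloballyMinimal] (p : ℕ) [Fact p.Prime] (hp2 : p ≠ 2)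
    (hmult : W.HasMultiplicativeReductionAtPrime p) (hirr : W.HasIrreducibleModPGaloisRep p)
    {N : ℕ} [NeZero N] {f : CuspForm (Gamma0 N) 2} (hf : IsNewformOf W f) :
    ∃ n : ℕ, 1 ≤ n ∧ ∃ a : (ZMod (p ^ n))ˣ,
      1 ≤ ‖((teichOrbitSum f p n (a : ZMod (p ^ n)) : ℚ) : ℚ_[p])‖ ∨
        ∃ t : ZMod (p ^ n), t ^ (p - 1) = 1 ∧
          1 ≤ ‖((ratPlusSymbol f (((t * (a : ZMod (p ^ n))).val : ℚ) / (p : ℚ) ^ n) -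
                  ratPlusSymbol f ((((a : ZMod (p ^ n))).val : ℚ) / (p : ℚ) ^ n) : ℚ) : ℚ_[p])‖ := by
  classical
  have hp : p.Prime := Fact.out
  have hpprime : Prime (p : ℤ) := Nat.prime_iff_prime_int.mp hp
  obtain ⟨k, u, hk, hu, hunit⟩ :=
    MultWinding.exists_one_le_norm_ratPlusSymbol_div_prime_pow W p hp2 hmult hirr hf
  haveI : NeZero (p ^ k) := ⟨pow_ne_zero _ hp.ne_zero⟩
  -- `a := u mod pᵏ`, a unit
  have hcop : IsCoprime ((p ^ k : ℕ) : ℤ) u := by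
    have h1 : IsCoprime (p : ℤ) u := (Irreducible.coprime_iff_not_dvd hpprime.irreducible).mpr hu
    simpa using h1.pow_left (m := k)
  have hua : IsUnit ((u : ℤ) : ZMod (p ^ k)) := (ZMod.coe_int_isUnit_iff_isCoprime u (p ^ k)).mpr hcop
  set a : (ZMod (p ^ k))ˣ := hua.unit with ha
  have hav : (a : ZMod (p ^ k)) = (u : ZMod (p ^ k)) := hua.unit_spec
  -- `[u/pᵏ]⁺ = [a.val/pᵏ]⁺`
  have hsym : ratPlusSymbol f ((u : ℚ) / (p : ℚ) ^ k) =
      ratPlusSymbol f ((((a : ZMod (p ^ k))).val : ℚ) / (p : ℚ) ^ k) := by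
    rw [hav]
    exact Summit.BirchSwinnertonDyer.BirchSwinnertonDyer.Cruxes.AnalyticMuZeroX9.TeichSpan.ratPlusSymbol_intCast_div_pow
      (f := f) (p := p) k u
  refine ⟨k, hk, a, ?_⟩
  by_contra H
  push Not at H
  obtain ⟨hsum, hdiff⟩ := H
  -- the orbit: exactly `p − 1` points
  set S : Finset (ZMod (p ^ k)) := Finset.univ.filter (fun t : ZMod (p ^ k) ↦ t ^ (p - 1) = 1) with hSdef
  haveI := neZero_torsionOrder p
  haveI := Fintype.ofFinite (rootsOfUnity (torsionOrder p) ℤ_[p])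
  have hScard : S.card = p - 1 := by
    rw [hSdef, ← image_toZModPow_rootsOfUnity_eq_filter p hp2 hk,
      Finset.card_image_of_injective _ (toZModPow_rootsOfUnity_injective_of_le p hp2 hk), Finset.card_univ,
      ← Nat.card_eq_fintype_card, card_rootsOfUnity_torsionOrder, torsionOrder_eq, if_neg hp2]
  -- split each term as `[a/pᵏ]⁺ + (difference)`
  have hsplit : (teichOrbitSum f p k (a : ZMod (p ^ k)) : ℚ) =
      (S.card : ℚ) * ratPlusSymbol f ((((a : ZMod (p ^ k))).val : ℚ) / (p : ℚ) ^ k) +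
        ∑ t ∈ S, (ratPlusSymbol f (((t * (a : ZMod (p ^ k))).val : ℚ) / (p : ℚ) ^ k) -
          ratPlusSymbol f ((((a : ZMod (p ^ k))).val : ℚ) / (p : ℚ) ^ k)) := by
    rw [teichOrbitSum_def, ← hSdef, Finset.sum_sub_distrib, Finset.sum_const, nsmul_eq_mul]
    ring
  have hdsmall : ‖((∑ t ∈ S, (ratPlusSymbol f (((t * (a : ZMod (p ^ k))).val : ℚ) / (p : ℚ) ^ k) -
      ratPlusSymbol f ((((a : ZMod (p ^ k))).val : ℚ) / (p : ℚ) ^ k)) : ℚ) : ℚ_[p])‖ < 1 := by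
    push_cast
    refine Finset.sum_induction _ (fun x => ‖x‖ < 1)
      (fun x y hx hy => lt_of_le_of_lt (Padic.nonarchimedean x y) (max_lt hx hy)) (by simp) fun t ht ↦ ?_
    have := hdiff t (Finset.mem_filter.mp ht).2
    push_cast at this
    exact this
  have hcardnorm : ‖((S.card : ℚ) : ℚ_[p])‖ = 1 := by
    rw [hScard]
    have h1 : (((p - 1 : ℕ) : ℚ) : ℚ_[p]) = (((p - 1 : ℕ) : ℤ) : ℚ_[p]) := by norm_cast
    rw [h1]
    refine le_antisymm (Padic.norm_int_le_one _) (not_lt.mp fun hlt ↦ ?_)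
    rw [Padic.norm_intCast_lt_one_iff] at hlt
    have h2 : p ∣ p - 1 := by exact_mod_cast hlt
    have hp2le := hp.two_le
    have h3 := Nat.le_of_dvd (by omega) h2
    omega
  have hmain : 1 ≤ ‖(((S.card : ℚ) * ratPlusSymbol f ((((a : ZMod (p ^ k))).val : ℚ) / (p : ℚ) ^ k) : ℚ) : ℚ_[p])‖ := by
    push_cast; rw [norm_mul]; push_cast at hcardnorm; rw [hcardnorm, one_mul, ← hsym]; exact hunit
  -- ultrametric: unit + small = unit
  have hlt : ‖((teichOrbitSum f p k (a : ZMod (p ^ k)) : ℚ) : ℚ_[p])‖ < 1 := hsum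
  rw [hsplit] at hlt
  push_cast at hlt hmain hdsmall
  set x := ((S.card : ℚ) : ℚ_[p]) * ((ratPlusSymbol f ((((a : ZMod (p ^ k))).val : ℚ) / (p : ℚ) ^ k) : ℚ) : ℚ_[p]) with hx
  set y := ∑ t ∈ S, (((ratPlusSymbol f (((t * (a : ZMod (p ^ k))).val : ℚ) / (p : ℚ) ^ k) : ℚ) : ℚ_[p]) -
      ((ratPlusSymbol f ((((a : ZMod (p ^ k))).val : ℚ) / (p : ℚ) ^ k) : ℚ) : ℚ_[p])) with hy
  have hxy : ‖x‖ ≤ max ‖x + y‖ ‖y‖ := by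
    have := Padic.nonarchimedean (x + y) (-y)
    rwa [add_neg_cancel_right, norm_neg] at this
  have : ‖x‖ < 1 := lt_of_le_of_lt hxy (max_lt hlt hdsmall)
  exact absurd hmain (not_le.mpr this)

/-- **The pair-level reading**: at a multiplicative odd `p` with `E[p]` irreducible, EITHER unit Teichmüller orbit sums exist for
every newform of `W` (`MultTeich.MultTeichOrbitUnitAt W p` — hence `X11a.MuAnZeroAt W p` by S3 + §2, mod Mazur/Wuthrich facts), OR
some newform of `W` has an orbit with two incongruent plus symbols and NO unit orbit sum (the honest residual of `stub_muAnDeepFive`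
at that pair, displayed in finite modular-symbol currency). [cite: MazurTateTeitelbaum1986Invent, §I.10 (10.1)] [cite: GreenbergLNM1716, Conj. 1.11] -/
theorem multTeichOrbitUnitAt_or_exists_orbit_nonconstant
    (W : WeierstrassCurve ℚ) [W.IsElliptic] [W.IsGloballyMinimal] (p : ℕ) [Fact p.Prime] (hp2 : p ≠ 2)
    (hmult : W.HasMultiplicativeReductionAtPrime p) (hirr : W.HasIrreducibleModPGaloisRep p) :
    MultTeichOrbitUnitAt W p ∨
      ∃ (N : ℕ) (_ : NeZero N) (f : CuspForm (Gamma0 N) 2), IsNewformOf W f ∧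
        (∀ n : ℕ, 1 ≤ n → ∀ a : (ZMod (p ^ n))ˣ, ‖((teichOrbitSum f p n (a : ZMod (p ^ n)) : ℚ) : ℚ_[p])‖ < 1) ∧
        ∃ n : ℕ, 1 ≤ n ∧ ∃ a : (ZMod (p ^ n))ˣ, ∃ t : ZMod (p ^ n), t ^ (p - 1) = 1 ∧
          1 ≤ ‖((ratPlusSymbol f (((t * (a : ZMod (p ^ n))).val : ℚ) / (p : ℚ) ^ n) -
                  ratPlusSymbol f ((((a : ZMod (p ^ n))).val : ℚ) / (p : ℚ) ^ n) : ℚ) : ℚ_[p])‖ := by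
  by_cases h : MultTeichOrbitUnitAt W p
  · exact Or.inl h
  · right
    simp only [MultTeichOrbitUnitAt, not_forall, not_exists, not_and, not_le] at h
    obtain ⟨N, hN, f, hf, hsmall⟩ := h
    obtain ⟨n, hn, a, hor⟩ := teichOrbitSum_unit_or_orbit_nonconstant W p hp2 hmult hirr hf
    refine ⟨N, hN, f, hf, fun n hn a ↦ hsmall n hn a, n, hn, a, ?_⟩
    rcases hor with hbig | hnc
    · exact absurd (hsmall n hn a) (not_lt.mpr hbig)
    · exact hnc

end Summit.BirchSwinnertonDyer.BirchSwinnertonDyer.Theorems.X11aLowerHalfEvenBranch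

end
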